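import Summits.ResolutionOfSingularities.ResolutionOfSingularities.Theorems.FrobeniusClosingPatchingRelPerfectDepthPhaseCContactTower
import Summits.ResolutionOfSingularities.ResolutionOfSingularities.Theorems.FrobeniusClosingPatchingRelPerfectDepthPhaseCContactLegality
import HarnessLib

/-!
# Crux `PatchingRelPerfect` (stmt-ResolutionOfSingularities-16161), chain W5.2 — F7(β) (β-AX) X3 C-I (M2b-T), (T-e′)/(T-e″): THE CONTACT TOWER
# WITH LEGALITY AND END DATA (`…DepthPhaseCContactTowerLegal`)

[OURS · L1 W5.2 · F7(β) (β-AX) X3 C-I (M2b-T) · res-L1-w52-plan-1 RULING G12-32 (iii) / G12-46 (2), hand res-D-repro-1 AS res-L1-repro-3; over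
res-D-pv-021΄s (T-b′) `ContactRealisation.centresOver_singOrBoundary`] The tower of (T-e) `ContactTower.exists_contactTower` (p570412) re-run
through (T-b′): the push-forward of the REALISED Cossart–Jannsen–Saito sequence of the reduced contact surface inside the carrier now carries
BOTH containment clauses — centres over `𝒳` AND centres over the LEGALITY SET `ι(T₀)`, `T₀ = Sing(𝒳_G) ∪ (𝒳_G ∩ B)` (quotient-stalk form,
on the carrier) —, and KEEPS F-60΄s end data (`Z₁`, the identification `e : tG.top ≅ Z₁`, `X₁`, `B₁`, the `𝓑`-permissible sequence, `X₁`
regular, `B₁` a strict normal crossings divisor, `X₁ ⋔ B₁`, `π⁻¹(𝒳_G ∪ B) = X₁ ∪ B₁`) for the END extraction (T-c) (res-D-pv-034).  With the LEG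
clause of `HasContactFormAt` rev 3 (Sketch v20) read through the Sing bridge (T-g), the second clause becomes `CentresOver (cosupp K♭|_U)`.
F-60 `CossartJannsenSaito2020EmbeddedSequenceBoundary` is a HYPOTHESIS (`hF60`): conditional helper, honest fact list ⟨F-60⟩.  Def-free; NOT a
statement of the manuscript under review; AI-written, weaker than expert review.

## References
* V. Cossart, U. Jannsen, S. Saito, *Desingularization: Invariants and Strategy* (LNM 2270, 2020), Thm. 1.4, Thm. 6.9 (a). [CossartJannsenSaito2020]
* J. Kollár, *Lectures on Resolution of Singularities* (2007), 3.30.3, Cor. 3.85. [Kollar2007]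
-/

-- `Summit.<Summit>.<Sub>.Theorems` with `Sub = Summit` (single-conjunct summit, D-0017)
set_option linter.dupNamespace false

noncomputable section

open CategoryTheory AlgebraicGeometry TopologicalSpace IsLocalRing
open Literature.AlgebraicGeometry.Resolution
open Scheme.IdealSheafData

namespace Summit.ResolutionOfSingularities.ResolutionOfSingularities.Theorems

namespace ContactTower

universe u

variable {Y : Scheme.{u}} {H : Y.IdealSheafData} {𝒳 : Closeds Y}

/-- [OURS · L1 W5.2 · F7(β) (β-AX) X3 C-I (M2b-T) (T-e′)/(T-e″)] **THE CONTACT TOWER WITH LEGALITY AND END DATA** (conditional on F-60 as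
the hypothesis `hF60`): as `exists_contactTower`, plus `t.CentresOver (ι '' T₀)` for the legality set `T₀ = Sing(𝒳_G) ∪ (𝒳_G ∩ B)` of the reduced
contact surface inside the carrier (res-D-pv-021΄s `centresOver_singOrBoundary`), plus F-60΄s end data on the top of the carrier sequence.
[cite: CossartJannsenSaito2020, Thm. 1.4 (pp. 5–6), Thm. 6.9 (a) (p. 83)] [cite: Kollar2007, 3.30.3, Cor. 3.85] -/
theorem exists_contactTower_legal [IsNoetherian Y] [DecidableEq Y.IdealSheafData] {BX : List Y.IdealSheafData}
    (hF60 : CossartJannsenSaito2020EmbeddedSequenceBoundary.{u})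
    (hY : Scheme.IsRegular Y) (hYe : Scheme.IsExcellent Y) (hsnc : HasSNC (H :: BX))
    (hdim : topologicalKrullDim (vanishingIdeal (𝒳.preimage H.subschemeι.continuous)).subscheme ≤ 2)
    (hcomp : ∀ T ∈ irreducibleComponents ((vanishingIdeal (𝒳.preimage H.subschemeι.continuous)).subscheme : Type u),
      ¬ T ⊆ (vanishingIdeal (𝒳.preimage H.subschemeι.continuous)).subschemeι ⁻¹'
        (⋃ D ∈ (BX.filter fun D => D ≠ H).map (fun D => D.comap H.subschemeι), (D.support : Set H.subscheme))) :
    ∃ (tG : CentreSeq H.subscheme) (Z₁ : Scheme.{u}) (π : Z₁ ⟶ H.subscheme) (X₁ B₁ : Set Z₁) (e : tG.top ≅ Z₁),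
      -- F-60΄s end data on the carrier
      IsBPermissibleSequenceB (H.subschemeι ⁻¹' (𝒳 : Set Y))
        (⋃ D ∈ (BX.filter fun D => D ≠ H).map (fun D => D.comap H.subschemeι), (D.support : Set H.subscheme)) π X₁ B₁ ∧
      Scheme.IsRegular Z₁ ∧ Scheme.IsRegular (vanishingIdeal ⟨closure X₁, isClosed_closure⟩).subscheme ∧
      IsStrictNormalCrossingsDivisor Z₁ B₁ ∧ IsTransversalWith Z₁ X₁ B₁ ∧
      π ⁻¹' (H.subschemeι ⁻¹' (𝒳 : Set Y) ∪
        ⋃ D ∈ (BX.filter fun D => D ≠ H).map (fun D => D.comap H.subschemeι), (D.support : Set H.subscheme)) = X₁ ∪ B₁ ∧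
      e.hom ≫ π = tG.comp ∧ tG.AllRegular ∧
      -- the pushed-forward tower on the patch
      (tG.pushforward H.subschemeι).AllRegular ∧ (tG.pushforward H.subschemeι).CentresOver (𝒳 : Set Y) ∧
      (tG.pushforward H.subschemeι).CentresOver (H.subschemeι ''
        ({z | z ∈ closure (H.subschemeι ⁻¹' (𝒳 : Set Y)) ∧ ¬ IsRegularLocalRing ((H.subscheme.presheaf.stalk z) ⧸
            stalkIdeal (vanishingIdeal ⟨closure (H.subschemeι ⁻¹' (𝒳 : Set Y)), isClosed_closure⟩) z)} ∪
          (closure (H.subschemeι ⁻¹' (𝒳 : Set Y)) ∩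
            ⋃ D ∈ (BX.filter fun D => D ≠ H).map (fun D => D.comap H.subschemeι), (D.support : Set H.subscheme)))) ∧
      Scheme.IsRegular (tG.pushforward H.subschemeι).top ∧
      (∀ x ∈ (tG.pushforwardι H.subschemeι).ker.support, ∃ w : (tG.pushforward H.subschemeι).top.presheaf.stalk x,
        stalkIdeal (tG.pushforwardι H.subschemeι).ker x = Ideal.span {w} ∧
          w ∉ (maximalIdeal ((tG.pushforward H.subschemeι).top.presheaf.stalk x)) ^ 2) ∧
      ∀ K : Y.IdealSheafData,
        (K.comap (tG.pushforward H.subschemeι).comp).comap (tG.pushforwardι H.subschemeι) = (K.comap H.subschemeι).comap tG.comp := by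
  haveI : IsNoetherian H.subscheme := isNoetherian_carrier H
  haveI : IsReduced (vanishingIdeal (𝒳.preimage H.subschemeι.continuous)).subscheme := isReduced_surface H 𝒳
  obtain ⟨hGreg, hGexc, hHgen, -, hB⟩ := ContactCarrier.carrierPatch (H := H) (BX := BX) hYe hsnc
  -- F-60 on the carrier
  obtain ⟨Z₁, π, X₁, B₁, hseq, hZ₁, -, -, -, hX₁, hB₁, htot, htr⟩ :=
    hF60 _ _ (vanishingIdeal (𝒳.preimage H.subschemeι.continuous)).subschemeι _ hGreg hGexc hdim hB hcomp
  rw [range_surfaceι] at hseq htot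
  -- realise it with both containment clauses
  obtain ⟨-, -, -, tG, e, he, hreg, hover, hoverT⟩ := ContactRealisation.centresOver_singOrBoundary hseq
  have hcl : closure (H.subschemeι ⁻¹' (𝒳 : Set Y)) = H.subschemeι ⁻¹' (𝒳 : Set Y) :=
    (𝒳.isClosed.preimage H.subschemeι.continuous).closure_eq
  have hover' : tG.CentresOver (H.subschemeι ⁻¹' (𝒳 : Set Y)) := by rwa [hcl] at hover
  -- push forward along the carrier embedding
  obtain ⟨h1, h2, h3⟩ := ContactPushforward.allRegular_pushforward tG H.subschemeι hY hHgen hreg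
  refine ⟨tG, Z₁, π, X₁, B₁, e, hseq, hZ₁, hX₁, hB₁, htr, htot, he, hreg, h1,
    ContactPushforward.centresOver_pushforward tG H.subschemeι _ hover', ?_, h2, h3,
    fun K => ContactPushforward.comap_pushforward_comp tG H.subschemeι K⟩
  exact ContactPushforward.centresOver_pushforward tG H.subschemeι _
    (CentreSeq.CentresOver.mono tG (fun z hz => Set.mem_image_of_mem _ hz) hoverT)

end ContactTower

end Summit.ResolutionOfSingularities.ResolutionOfSingularities.Theorems

end
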